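import Mathlib
import HarnessLib
import Literature.Analysis.FluidPDE.LocalTypeIBlowup.SingularVertexZoom
import Summits.NavierStokesRegularity.NavierStokesRegularity.Theorems.TypeIQuarterGateScarEnvelopeTypeITranslatedPersistence

/-!
# Line `scar_zoom` on crux `TypeIQuarterGate.ScarEnvelopeTypeI` (stmt-NavierStokesRegularity-23843) —
# tools for STUB B `stub_scarZoom`, file 2: the compactness engine with persistence at EVERY
# blow-up point of the closed backward slab

Helper file (no new definitions).  `local_typeI_compactness_twin` is the tree's
`LocalTypeIBlowup.local_typeI_compactness_singular` (Albritton–Barker 2019, §3 with Lemma 2.2 and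
Prop. 2.3; Barker–Prange 2020, Lemma 3 and §4 Step 3: compactness of Type-I-bounded suitable weak
solutions given on the growing balls `Q(0, 2ᵐ)`, with persistence of a singular ORIGIN) re-run
with ONE change in the last step: persistence of singularities is exported at every point `z` of the
closed backward slab (`z.1 ≤ 0`) at which the approximants blow up in `L^∞(Q(z, R))` along the
extracted subsequence, `0 < R < 1` — by `isBackwardSingularPoint_of_translated_persistence` (file 1),
which consumes the weak convergence of the normalised pressures along the same subsequence (not
exported by the tree's engine; hence the re-run, exactly as the tree's file 13 re-ran file `Engine`).
Steps 0–4 are copied verbatim from the tree (pressure normalisation, uniform `L³ × L^{3/2}` bounds,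
`local_suitableCompactness`, slab suitability and weak gradient by exhaustion, `𝐈 ≤ 4 I` by lower
semicontinuity).  The twin-scar zoom (file 3) uses the clause twice: at the origin and at the
satellite point `(0, e)`, `‖e‖ = 1`.

Bookkeeping only; no statement about the crux, its parent or the summit is proved here.
-/

noncomputable section

-- the summit-side namespace `Summit.NavierStokesRegularity.NavierStokesRegularity.…` (single-conjunct
-- summit, D-0017) repeats a component by design; the dupNamespace linter would flag every declaration.
set_option linter.dupNamespace false

namespace Summit.NavierStokesRegularity.NavierStokesRegularity.Cruxes.ScarEnvelopeTypeI.ScarZoom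

open MeasureTheory Set Function Filter Topology TopologicalSpace Metric
open scoped NNReal ENNReal
open Literature.Analysis Literature.Analysis.FluidPDE Literature.Analysis.FluidPDE.LocalTypeIBlowup

/-- `n + 1 ≤ 2 ^ (n + 1)` in `ℝ`. -/
private theorem nat_succ_le_two_pow' (n : ℕ) : ((n : ℝ) + 1) ≤ (2 : ℝ) ^ (n + 1) := by
  have h : n + 1 ≤ 2 ^ (n + 1) := (Nat.lt_two_pow_self (n := n + 1)).le
  exact_mod_cast h

/-- **Compactness of Type-I-bounded suitable weak solutions given on growing balls, with
persistence of singularities at every blow-up point of the closed backward slab**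
(Albritton–Barker 2019, §3 with Lemma 2.2 and Prop. 2.3; Barker–Prange 2020, Lemma 3 and §4
Step 3; Rusin–Šverák 2011, Lemma 2.1).  Let `(v_k, q_k)` be in Albritton–Barker's class Def. 2.1 on
`Q(0, 2ᵐ)` for all `m ≤ k`, with weak spatial gradients `G_k` there and
`𝐈(Q(0, 2ᵐ); v_k, q_k, G_k) ≤ I < ∞`.  Then along a subsequence `σ` the `v_{σ j}` converge in
`L³(Q(0, R))` for every `R > 0` to a suitable weak solution `(u, p)` on the backward slab with a weak
gradient `H` and `𝐈(u, p, H) ≤ 4 I`, `u ∈ L³(Q(0, R))` for every `R > 0`; and for every point `z` with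
`z.1 ≤ 0`: IF the approximants blow up in `L^∞(Q(z, R))` along `σ` for every `0 < R < 1`, then `z`
is a backward singular point of `u`.  (The tree's `local_typeI_compactness_singular` is the case
`z = 0`; Steps 0–4 of the proof are copied from it verbatim.) -/
theorem local_typeI_compactness_twin (I : ℝ≥0∞)
    (v : ℕ → ℝ → (EuclideanSpace ℝ (Fin 3)) → (EuclideanSpace ℝ (Fin 3)))
    (q : ℕ → ℝ → (EuclideanSpace ℝ (Fin 3)) → ℝ)
    (G : ℕ → ℝ → (EuclideanSpace ℝ (Fin 3)) → (EuclideanSpace ℝ (Fin 3)) →L[ℝ] (EuclideanSpace ℝ (Fin 3)))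
    (hI : I < ⊤)
    (hball : ∀ m k : ℕ, m ≤ k → IsSuitableWeakSolutionInBall ((2 : ℝ) ^ m) 0 (v k) (q k))
    (hwg : ∀ m k : ℕ, m ≤ k →
      HasWeakSpatialGradientOn (parabolicCylinderOpens ((2 : ℝ) ^ m) (0 : ℝ × (EuclideanSpace ℝ (Fin 3))))
        (v k) (G k))
    (hbd : ∀ m k : ℕ, m ≤ k →
      typeIBound (parabolicCylinder ((2 : ℝ) ^ m) (0 : ℝ × (EuclideanSpace ℝ (Fin 3)))) (v k) (q k) (G k) ≤ I) :
    ∃ (u : ℝ → (EuclideanSpace ℝ (Fin 3)) → (EuclideanSpace ℝ (Fin 3)))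
      (p : ℝ → (EuclideanSpace ℝ (Fin 3)) → ℝ)
      (H : ℝ → (EuclideanSpace ℝ (Fin 3)) → (EuclideanSpace ℝ (Fin 3)) →L[ℝ] (EuclideanSpace ℝ (Fin 3)))
      (σ : ℕ → ℕ),
      StrictMono σ ∧
      IsSuitableWeakSolutionOn (slab (EuclideanSpace ℝ (Fin 3)) (Iio 0) isOpen_Iio) 1 0 u p ∧
      HasWeakSpatialGradientOn (slab (EuclideanSpace ℝ (Fin 3)) (Iio 0) isOpen_Iio) u H ∧
      typeIBound (Iio (0 : ℝ) ×ˢ univ) u p H ≤ 4 * I ∧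
      (∀ R : ℝ, 0 < R → MemLp (uncurry u) 3
        (volume.restrict (parabolicCylinder R (0 : ℝ × (EuclideanSpace ℝ (Fin 3)))))) ∧
      (∀ R : ℝ, 0 < R → Tendsto (fun j => eLpNorm (uncurry (v (σ j)) - uncurry u) 3
        (volume.restrict (parabolicCylinder R (0 : ℝ × (EuclideanSpace ℝ (Fin 3)))))) atTop (𝓝 0)) ∧
      (∀ z : ℝ × (EuclideanSpace ℝ (Fin 3)), z.1 ≤ 0 →
        (∀ R ∈ Ioo (0 : ℝ) 1, limsup (fun j => eLpNorm (uncurry (v (σ j))) ⊤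
          (volume.restrict (parabolicCylinder R z))) atTop = ⊤) →
        IsBackwardSingularPoint u z) := by
  have hItop : I ≠ ⊤ := hI.ne
  have hcc_pos : ∀ m : ℕ, (0 : ℝ) < (2 : ℝ) ^ m := fun m => by positivity
  have hcc_one : ∀ m : ℕ, (1 : ℝ) ≤ (2 : ℝ) ^ m := fun m => one_le_pow₀ (by norm_num)
  -- ## Step 0: normalise the pressures to unit-ball mean zero
  set qn : ℕ → ℝ → (EuclideanSpace ℝ (Fin 3)) → ℝ :=
    fun k t x => q k t x - ⨍ y in ball (0 : (EuclideanSpace ℝ (Fin 3))) 1, q k t y with hqn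
  have hballn : ∀ m k : ℕ, m ≤ k → IsSuitableWeakSolutionInBall ((2 : ℝ) ^ m) 0 (v k) (qn k) :=
    fun m k hmk => isSuitableWeakSolutionInBall_sub_unitBallMean (hcc_one m) (hball m k hmk)
  have hbdn : ∀ m k : ℕ, m ≤ k →
      typeIBound (parabolicCylinder ((2 : ℝ) ^ m) (0 : ℝ × (EuclideanSpace ℝ (Fin 3)))) (v k) (qn k) (G k) ≤ I := by
    intro m k hmk
    show typeIBound _ (v k) (fun t x => q k t x - ⨍ y in ball (0 : (EuclideanSpace ℝ (Fin 3))) 1, q k t y)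
      (G k) ≤ I
    rw [typeIBound_sub_unitBallMean_ball (hball m k hmk).2.2.2]
    exact hbd m k hmk
  have h0 : ∀ k t, ⨍ y in ball (0 : (EuclideanSpace ℝ (Fin 3))) 1, qn k t y = 0 := fun k t =>
    unitBallMean_normalised (q k) t
  -- ## Step 1: the uniform `L³ × L^{3/2}` bounds at every level
  have hbd2 : ∀ m : ℕ, (⨆ k, ⨆ (_ : m ≤ k), (eLpNorm (uncurry (v k)) 3
        (volume.restrict (parabolicCylinder ((2 : ℝ) ^ m) (0 : ℝ × (EuclideanSpace ℝ (Fin 3))))) +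
      eLpNorm (uncurry (qn k)) (3 / 2)
        (volume.restrict (parabolicCylinder ((2 : ℝ) ^ m) (0 : ℝ × (EuclideanSpace ℝ (Fin 3))))))) < ∞ := by
    intro m
    set Cv : ℝ≥0∞ := (ENNReal.ofReal ((2 : ℝ) ^ m) ^ 2 * I) ^ (1 / 3 : ℝ) with hCv
    set Cq : ℝ≥0∞ := (2 * (1 + volume (ball (0 : (EuclideanSpace ℝ (Fin 3))) ((2 : ℝ) ^ m)) *
        (volume (ball (0 : (EuclideanSpace ℝ (Fin 3))) 1))⁻¹) * (ENNReal.ofReal ((2 : ℝ) ^ m) ^ 2 * I)) ^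
          (2 / 3 : ℝ) with hCq
    refine lt_of_le_of_lt (iSup₂_le fun k hmk => add_le_add ?_ ?_) (b := Cv + Cq) ?_
    · refine (eLpNorm_velocity_ball_le (hcc_pos m) Subset.rfl (qn k) (G k)).trans ?_
      exact ENNReal.rpow_le_rpow (mul_le_mul' le_rfl (hbdn m k hmk)) (by norm_num)
    · refine (eLpNorm_pressure_ball_le (hcc_one m) (hballn m k hmk).2.2.2.1 (h0 k) Subset.rfl
        (v k) (G k)).trans ?_
      exact ENNReal.rpow_le_rpow (mul_le_mul' le_rfl (mul_le_mul' le_rfl (hbdn m k hmk))) (by norm_num)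
    · refine ENNReal.add_lt_top.2 ⟨?_, ?_⟩
      · exact ENNReal.rpow_lt_top_of_nonneg (by norm_num)
          (ENNReal.mul_ne_top (ENNReal.pow_ne_top ENNReal.ofReal_ne_top) hItop)
      · refine ENNReal.rpow_lt_top_of_nonneg (by norm_num) ?_
        rw [← mul_assoc]
        exact ENNReal.mul_ne_top (pressureConst_lt_top ((2 : ℝ) ^ m)).ne hItop
  -- ## Step 2: the limit along one subsequence
  obtain ⟨u, p, σ, hσ, hlim⟩ := local_suitableCompactness hballn hbd2
  -- ## Step 3: suitability on the slab and the weak gradient, by exhaustion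
  have hswu : IsSuitableWeakSolutionOn (slab (EuclideanSpace ℝ (Fin 3)) (Iio 0) isOpen_Iio) 1 0 u p :=
    ESSBlowup.isSuitableWeakSolutionOn_halfspace fun a ha => (hlim a ha).1
  set Qn : ℕ → Opens (ℝ × (EuclideanSpace ℝ (Fin 3))) :=
    fun n => parabolicCylinderOpens ((n : ℝ) + 1) (0 : ℝ × (EuclideanSpace ℝ (Fin 3))) with hQn
  have hmono : Monotone Qn := fun m n hmn z hz =>
    SuitableCompactness.parabolicCylinder_zero_mono (by positivity) (by simpa using hmn) hz
  have hcov : ∀ K ⊆ ((slab (EuclideanSpace ℝ (Fin 3)) (Iio 0) isOpen_Iio :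
      Opens (ℝ × (EuclideanSpace ℝ (Fin 3)))) : Set (ℝ × (EuclideanSpace ℝ (Fin 3)))),
      IsCompact K → ∃ n, K ⊆ (Qn n : Set (ℝ × (EuclideanSpace ℝ (Fin 3)))) := fun K hK hKc =>
    ESSBlowup.exists_subset_parabolicCylinder_of_isCompact hK hKc
  choose Gn hGn hGn2 using fun n : ℕ => (hlim ((n : ℝ) + 1) (by positivity)).1.2.2.1
  obtain ⟨H, hH, hHae⟩ := exists_hasWeakSpatialGradientOn_of_exhaustion
    (Q := slab (EuclideanSpace ℝ (Fin 3)) (Iio 0) isOpen_Iio) (Qn := Qn) hmono hcov hGn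
  -- ## Step 4: `𝐈(u, p, H) ≤ 4 I` by lower semicontinuity of `A, C, D, E` on every admissible ball
  have h4I : typeIBound (Iio (0 : ℝ) ×ˢ univ) u p H ≤ 4 * I := by
    refine typeIBound_le_iff.2 fun r hr z hz => ?_
    obtain ⟨n, hn⟩ : ∃ n : ℕ, parabolicCylinder r z ⊆
        parabolicCylinder ((n : ℝ) + 1) (0 : ℝ × (EuclideanSpace ℝ (Fin 3))) := by
      obtain ⟨n, hn⟩ := exists_nat_ge (max (r ^ 2 - z.1) (‖z.2‖ + r))
      refine ⟨n, fun w hw => ?_⟩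
      have hw0 : w.1 < 0 := (hz hw).1
      rw [mem_parabolicCylinder] at hw
      rw [SuitableCompactness.mem_parabolicCylinder_zero]
      have h1 : r ^ 2 - z.1 ≤ n := (le_max_left _ _).trans hn
      have h2 : ‖z.2‖ + r ≤ n := (le_max_right _ _).trans hn
      have h3 : (n : ℝ) ≤ ((n : ℝ) + 1) ^ 2 := by nlinarith [n.cast_nonneg (α := ℝ)]
      refine ⟨⟨by linarith [hw.1.1], hw0⟩, ?_⟩
      calc ‖w.2‖ = ‖(w.2 - z.2) + z.2‖ := by rw [sub_add_cancel]
        _ ≤ ‖w.2 - z.2‖ + ‖z.2‖ := norm_add_le _ _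
        _ < r + ‖z.2‖ := by rw [← dist_eq_norm]; linarith [hw.2]
        _ ≤ (n : ℝ) + 1 := by linarith
    set a : ℝ := (n : ℝ) + 1 with ha
    have ha0 : 0 < a := by positivity
    have ha1 : 1 ≤ a := by rw [ha]; linarith [n.cast_nonneg (α := ℝ)]
    set Q₀ : Set (ℝ × (EuclideanSpace ℝ (Fin 3))) :=
      parabolicCylinder a (0 : ℝ × (EuclideanSpace ℝ (Fin 3))) with hQ₀
    have hzQ : parabolicCylinder r z ⊆ Q₀ := hn
    obtain ⟨hballu, hum3, hconv, hweak⟩ := hlim a ha0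
    have hleΩ : parabolicCylinderOpens r z ≤
        (slab (EuclideanSpace ℝ (Fin 3)) (Iio 0) isOpen_Iio : Opens (ℝ × (EuclideanSpace ℝ (Fin 3)))) :=
      fun w hw => hz hw
    set m₀ : ℕ := n + 1 with hm₀
    have ham₀ : a ≤ (2 : ℝ) ^ m₀ := nat_succ_le_two_pow' n
    have hQ₀m : Q₀ ⊆ parabolicCylinder ((2 : ℝ) ^ m₀) (0 : ℝ × (EuclideanSpace ℝ (Fin 3))) :=
      parabolicCylinder_mono ha0.le ham₀ _
    have hzm : parabolicCylinder r z ⊆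
        parabolicCylinder ((2 : ℝ) ^ m₀) (0 : ℝ × (EuclideanSpace ℝ (Fin 3))) := hzQ.trans hQ₀m
    have hleΩm : parabolicCylinderOpens r z ≤
        parabolicCylinderOpens ((2 : ℝ) ^ m₀) (0 : ℝ × (EuclideanSpace ℝ (Fin 3))) :=
      fun w hw => hzm hw
    set σ' : ℕ → ℕ := fun j => σ (j + m₀) with hσ'
    have hσ'm : ∀ j, m₀ ≤ σ' j := fun j => (Nat.le_add_left m₀ j).trans (hσ.id_le (j + m₀))
    have hconv' : Tendsto (fun j => eLpNorm (uncurry (v (σ' j)) - uncurry u) 3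
        (volume.restrict Q₀)) atTop (𝓝 0) := hconv.comp (tendsto_add_atTop_nat m₀)
    have hweak' : ∀ g : ℝ × (EuclideanSpace ℝ (Fin 3)) → ℝ, MemLp g 3 (volume.restrict Q₀) →
        Tendsto (fun j => ∫ w in Q₀, qn (σ' j) w.1 w.2 * g w) atTop
          (𝓝 (∫ w in Q₀, p w.1 w.2 * g w)) := fun g hg =>
      (hweak g hg).comp (tendsto_add_atTop_nat m₀)
    have hbdσ : ∀ j, abScaledSum r z (v (σ' j)) (qn (σ' j)) (G (σ' j)) ≤ I := fun j =>
      (abScaledSum_le_typeIBound hr hzm).trans (hbdn m₀ (σ' j) (hσ'm j))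
    have hvm : ∀ j, AEStronglyMeasurable (uncurry (v (σ' j))) (volume.restrict Q₀) := fun j =>
      (hballn m₀ (σ' j) (hσ'm j)).1.distributional.1.aestronglyMeasurable.mono_measure
        (Measure.restrict_mono hQ₀m le_rfl)
    have hum : AEStronglyMeasurable (uncurry u) (volume.restrict Q₀) := hum3.1
    have hA : cknAEss r z u ≤ I :=
      cknAEss_le_of_tendsto_eLpNorm hr hzQ hvm hum hconv'
        fun j => cknAEss_le_abScaledSum.trans (hbdσ j)
    have hC : cknC r z u ≤ I :=
      cknC_le_of_tendsto_eLpNorm hr hzQ hvm hum hconv'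
        fun j => cknC_le_abScaledSum.trans (hbdσ j)
    have hqmem : ∀ j, MemLp (uncurry (qn (σ' j))) (3 / 2) (volume.restrict Q₀) := fun j =>
      (hballn m₀ (σ' j) (hσ'm j)).2.2.2.mono_measure (Measure.restrict_mono hQ₀m le_rfl)
    have hD : cknDOsc r z p ≤ I :=
      cknDOsc_le_of_tendsto_weakly hr hzQ hqmem hballu.2.2.2 hweak'
        fun j => cknDOsc_le_abScaledSum.trans (hbdσ j)
    have hHfin : ∫⁻ w in parabolicCylinder r z, ENNReal.ofReal (frobeniusNormSq (H w.1 w.2)) < ∞ := by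
      have e : ∫⁻ w in parabolicCylinder r z, ENNReal.ofReal (frobeniusNormSq (H w.1 w.2)) =
          ∫⁻ w in parabolicCylinder r z, ENNReal.ofReal (frobeniusNormSq (Gn n w.1 w.2)) := by
        refine setLIntegral_congr_of_ae_imp (isOpen_parabolicCylinder r z).measurableSet hzQ ?_
        filter_upwards [hHae n] with w hw hwS
        have e : H w.1 w.2 = Gn n w.1 w.2 := hw hwS
        rw [e]
      rw [e]
      exact lt_of_le_of_lt (lintegral_mono_set hzQ) (hGn2 n)
    have hE : cknE r z H ≤ I :=
      cknE_le_of_tendsto_eLpNorm hr hzQ (fun j => (hwg m₀ (σ' j) (hσ'm j)).mono hleΩm)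
        (hH.mono hleΩ) hHfin hconv' fun j => cknE_le_abScaledSum.trans (hbdσ j)
    calc abScaledSum r z u p H = cknAEss r z u + cknC r z u + cknDOsc r z p + cknE r z H := rfl
      _ ≤ I + I + I + I := add_le_add (add_le_add (add_le_add hA hC) hD) hE
      _ = 4 * I := by ring
  -- ## Step 5: persistence of singularities at every blow-up point of the closed slab
  -- (A–B Prop. 2.3 = B–P Lemma 3, transported by translation: file `…TranslatedPersistence`)
  have hpers : ∀ z : ℝ × (EuclideanSpace ℝ (Fin 3)), z.1 ≤ 0 →
      (∀ R ∈ Ioo (0 : ℝ) 1, limsup (fun j => eLpNorm (uncurry (v (σ j))) ⊤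
        (volume.restrict (parabolicCylinder R z))) atTop = ⊤) →
      IsBackwardSingularPoint u z := fun z hz hsup =>
    isBackwardSingularPoint_of_translated_persistence hballn hbd2 hσ hlim hz hsup
  exact ⟨u, p, H, σ, hσ, hswu, hH, h4I, fun R hR => (hlim R hR).2.1, fun R hR => (hlim R hR).2.2.1,
    hpers⟩

end Summit.NavierStokesRegularity.NavierStokesRegularity.Cruxes.ScarEnvelopeTypeI.ScarZoom

end
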